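import Mathlib

/-!
# Rédei layer matching — level-1 census (crux idea `redei-layer-matching`, P2 / critic V#14 price P1)

Seat `planner-bsd-idea-20-g3-0` (bsd-idea-20 g3), crux item stmt-BirchSwinnertonDyer-19804, 2026-08-28.
No summit statement is proved by this file.

A SELF-CONTAINED, COMPUTABLE replica (native evaluation, `native_decide`) of the Legendre-symbol census
`d1_census.py` attached as evidence on stmt-19804:  for odd square-free `n ≡ 5, 7 (mod 8)`,
* `monskyS n`  = Monsky's `s(n) = 2k − rank_{𝔽₂} M`, `M = ( A + D₂  D₂ ; D₂  A + D₋₂ )`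
  (mirrors the tree's `HeathBrown1994.monskyMatrixOdd`; `#Sel₂(E_n) = 2^{2+s(n)}`),
* `gOdd d`      = `[4-rank of Cl(ℚ(√−d)) = 0]` = `g(d) = #2Cl(ℚ(√−d))` odd, via Rédei's matrix
  `e₄ = t − 1 − rank R` (mirrors `QuadraticFields.RedeiReichardt*` / Smith 2016's
  `odd_genusClassNumber_iff_det_updateCol`),
* `sigma1Odd n`, `sigma2Odd n` = parities of TYZ's genus sums `Σ₁` (`TianYuanZhang2017.genusSum₁`) and
  `Σ₂′` (`genusSum₂'`, WITH the `ℓ = 0` term) with `g ↦ gOdd`.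
The BRIDGE "these computable functions agree with the tree's definitions" is NOT proved here (typing
debt T1 of the card); the theorems below are kernel-accepted facts about THESE functions, cross-checked
against the independent Python implementation (identical counts for `n ≤ 10⁴`).

RESULT (`d1_empty_le_10000`): no odd square-free `n ≡ 5,7 (8)`, `n ≤ 10⁴`, has `s(n) ≥ 3` together with an
odd TYZ genus sum — TYZ's level 1 is mute on the whole `Ш[2] ≠ 0` locus (the habitat of the card's rung),
so the level-2 law K1 is unavoidable; and 18 such `n` with `s(n) = 1` are mute as well (`silent_s1_le_10000`),
so the exact level-1 law is the Legendre matrix, not the genus class-number parities.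
-/

set_option linter.dupNamespace false

namespace Summit.BirchSwinnertonDyer.BirchSwinnertonDyer.Cruxes.UpperOffV0HSYPlus.RedeiLayerMatching.Census

/-- `a ^ e mod m` by binary powering (structural fuel; `e < 2^64`). -/
def powModF : ℕ → ℕ → ℕ → ℕ → ℕ
  | 0, _, _, m => 1 % m
  | fuel + 1, a, e, m =>
    if e = 0 then 1 % m
    else
      let h := powModF fuel a (e / 2) m
      let h2 := h * h % m
      if e % 2 = 1 then h2 * (a % m) % m else h2

def powMod (a e m : ℕ) : ℕ := powModF 64 a e m

/-- Additive Legendre symbol: `true` iff `(a/p) = −1` (Euler's criterion; `p` an odd prime, `p ∤ a`). -/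
def legBit (a : ℤ) (p : ℕ) : Bool :=
  powMod (Int.toNat (a % (p : ℤ))) ((p - 1) / 2) p == p - 1

/-- Additive Kronecker symbol `(d/2)` for odd `d`: `true` iff `d ≡ ±3 (mod 8)`. -/
def kron2Bit (d : ℤ) : Bool :=
  let r := d % 8
  !(r == 1 || r == 7)

/-- Row bitmask from a list of bits (bit `i` = entry `i`). -/
def rowOf (bits : List Bool) : ℕ :=
  ((List.range bits.length).zip bits).foldl (fun acc ib => if ib.2 then acc ||| (1 <<< ib.1) else acc) 0

/-- Rank over `𝔽₂` of a list of row bitmasks with `w` columns (Gaussian elimination). -/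
def rankF2 (rows : List ℕ) (w : ℕ) : ℕ :=
  ((List.range w).foldl (fun (st : List ℕ × ℕ) c =>
    match st.1.find? (fun r => r.testBit c) with
    | none => st
    | some piv => ((st.1.erase piv).map (fun r => if r.testBit c then r ^^^ piv else r), st.2 + 1))
    (rows, 0)).2

def xorAll (l : List Bool) : Bool := l.foldl (fun a b => xor a b) false

/-- Distinct prime factors (ascending) and square-freeness test. -/
def primesOf (n : ℕ) : List ℕ := (Nat.primeFactorsList n).dedup

def isSquarefree (n : ℕ) : Bool := (Nat.primeFactorsList n).length == (primesOf n).length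

/-- Monsky's `s(n)` for odd square-free `n = p₁⋯p_k`: `2k − rank ( A + D₂  D₂ ; D₂  A + D₋₂ )`,
`A_{ij} = ((p_j/p_i))_add (i ≠ j)`, `A_{ii} = Σ_{l ≠ i} A_{il}`, `D_a = diag((a/p_i))_add`. -/
def monskyS (n : ℕ) : ℕ :=
  let ps := primesOf n
  let k := ps.length
  let idx := List.range k
  let A : ℕ → ℕ → Bool := fun i j =>
    if i = j then xorAll (idx.filterMap fun l => if l = i then none else some (legBit (ps.getD l 0) (ps.getD i 0)))
    else legBit (ps.getD j 0) (ps.getD i 0)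
  let D2 : ℕ → Bool := fun i => legBit 2 (ps.getD i 0)
  let Dm2 : ℕ → Bool := fun i => legBit (-2) (ps.getD i 0)
  let top := idx.map fun i => rowOf ((idx.map fun j => xor (A i j) (i == j && D2 i)) ++ (idx.map fun j => i == j && D2 i))
  let bot := idx.map fun i => rowOf ((idx.map fun j => i == j && D2 i) ++ (idx.map fun j => xor (A i j) (i == j && Dm2 i)))
  2 * k - rankF2 (top ++ bot) (2 * k)

/-- Prime discriminants `(dᵢ, pᵢ)` of `ℚ(√−d)`, `d > 0` square-free: odd `q ↦ q* = ±q ≡ 1 (4)`; even part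
`−4` if `d ≡ 1 (4)`, `−8`/`8` if `d = 2m`, `m ≡ 1 / 3 (4)`; none if `d ≡ 3 (4)`. -/
def primeDiscs (d : ℕ) : List (ℤ × ℕ) :=
  let odd := (primesOf d).filter (· != 2)
  let oddDiscs : List (ℤ × ℕ) := odd.map fun (q : ℕ) => ((if q % 4 = 1 then (q : ℤ) else -(q : ℤ)), q)
  if d % 2 = 1 then
    (if d % 4 = 3 then oddDiscs else oddDiscs ++ [((-4 : ℤ), 2)])
  else
    (if (d / 2) % 4 = 1 then oddDiscs ++ [((-8 : ℤ), 2)] else oddDiscs ++ [((8 : ℤ), 2)])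

/-- Rédei: `4`-rank of `Cl(ℚ(√−d))` = `t − 1 − rank R`, `R_{ij} = ((d_i/p_j))_add (i ≠ j)`, columns summing
to zero. -/
def e4 (d : ℕ) : ℕ :=
  let ds := primeDiscs d
  let t := ds.length
  if t ≤ 1 then 0 else
  let idx := List.range t
  let sym : ℕ → ℕ → Bool := fun i j =>
    let di := (ds.getD i (1, 1)).1
    let pj := (ds.getD j (1, 1)).2
    if pj = 2 then kron2Bit di else legBit di pj
  let M : ℕ → ℕ → Bool := fun i j =>
    if i = j then xorAll (idx.filterMap fun k => if k = i then none else some (sym k i)) else sym i j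
  let rows := idx.map fun i => rowOf (idx.map fun j => M i j)
  t - 1 - rankF2 rows t

/-- `g(d) = #2Cl(ℚ(√−d))` is odd iff the `4`-rank vanishes. -/
def gOdd (d : ℕ) : Bool := e4 d == 0

/-- Set partitions of a list (TYZ's non-ordered decompositions `n = d₀d₁⋯d_ℓ`, `dᵢ > 1`). -/
def setPartitions : List ℕ → List (List (List ℕ))
  | [] => [[]]
  | x :: xs => (setPartitions xs).flatMap fun part =>
      ([x] :: part) :: ((List.range part.length).map fun i =>
        ((List.range part.length).zip part).map fun jb => if jb.1 = i then x :: jb.2 else jb.2)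

def blocksToDivisors (part : List (List ℕ)) : List ℕ := part.map fun b => b.foldl (· * ·) 1

/-- Parity of TYZ's `Σ₁ = Σ_{decompositions, ≤ 1 factor ≢ 1 (8)} ∏ g(dᵢ)`. -/
def sigma1Odd (n : ℕ) : Bool :=
  xorAll ((setPartitions (primesOf n)).map fun part =>
    let D := blocksToDivisors part
    ((D.filter fun d => d % 8 != 1).length ≤ 1) && D.all gOdd)

/-- Parity of TYZ's `Σ₂′` (AS PRINTED, with the `ℓ = 0` term): decompositions having a factor `d₀ ≡ 5,6,7 (8)`
all of whose other factors are `≡ 1,2,3 (8)` with at most one of them `≢ 1 (8)`. -/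
def sigma2Odd (n : ℕ) : Bool :=
  xorAll ((setPartitions (primesOf n)).map fun part =>
    let D := blocksToDivisors part
    let idx := (List.range D.length).zip D
    (idx.any fun id0 =>
      (id0.2 % 8 == 5 || id0.2 % 8 == 6 || id0.2 % 8 == 7) &&
      (idx.all fun jd => jd.1 == id0.1 || (jd.2 % 8 == 1 || jd.2 % 8 == 2 || jd.2 % 8 == 3)) &&
      ((idx.filter fun jd => jd.1 != id0.1 && jd.2 % 8 != 1).length ≤ 1))
    && D.all gOdd)

/-- The census habitat: odd square-free `n ≡ 5, 7 (mod 8)`, `n > 1`. -/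
def inHabitat (n : ℕ) : Bool :=
  decide (1 < n) && n % 2 == 1 && (n % 8 == 5 || n % 8 == 7) && isSquarefree n

/-- A member of `𝒟₁`: `s(n) ≥ 3` and a TYZ genus sum odd. -/
def bad (n : ℕ) : Bool := inHabitat n && decide (3 ≤ monskyS n) && (sigma1Odd n || sigma2Odd n)

def countUpTo (N : ℕ) (f : ℕ → Bool) : ℕ := ((List.range (N + 1)).filter f).length

/-! ### Validation (same test values as the Python script) -/

/-- `s(p)` on the four odd residue classes: `p ≡ 3, 5, 7, 1 (8) ↦ 0, 1, 1, 2`. -/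
theorem monskyS_primes : [monskyS 3, monskyS 5, monskyS 7, monskyS 17, monskyS 11, monskyS 13,
    monskyS 23, monskyS 41] = [0, 1, 1, 2, 0, 1, 1, 2] := by native_decide

/-- Rédei `4`-ranks against known class groups: `Cl(ℚ(√−d))` for
`d = 14, 17, 41, 34, 39, 55, 46, 62, 82, 65, 66, 145, 69` has an element of order `4`;
for `d = 5, 21, 30, 35, 33, 57, 42, 70, 10, 26` it has none. -/
theorem e4_known : ((([14, 17, 41, 34, 39, 55, 46, 62, 82, 65, 66, 145, 69] : List ℕ).map e4),
    (([5, 21, 30, 35, 33, 57, 42, 70, 10, 26] : List ℕ).map e4)) =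
    ([1, 1, 1, 1, 1, 1, 1, 1, 1, 1, 1, 1, 1], [0, 0, 0, 0, 0, 0, 0, 0, 0, 0]) := by native_decide

/-! ### The census for `n ≤ 10⁴` (Python `d1_census.py 10000`: habitat 2032, `s ≥ 3`: 164, all `s = 3`,
silent `s = 1`: 18, loud: 1850, `𝒟₁ = ∅`) -/

theorem habitat_count_le_10000 : countUpTo 10000 inHabitat = 2032 := by native_decide

theorem s_ge_three_count_le_10000 :
    countUpTo 10000 (fun n => inHabitat n && decide (3 ≤ monskyS n)) = 164 := by native_decide

theorem loud_count_le_10000 :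
    countUpTo 10000 (fun n => inHabitat n && (sigma1Odd n || sigma2Odd n)) = 1850 := by native_decide

/-- The `s(n) = 1` members on which BOTH genus sums are even (first two: `805`, `6279`). -/
theorem silent_s1_le_10000 :
    countUpTo 10000 (fun n => inHabitat n && monskyS n == 1 && !(sigma1Odd n || sigma2Odd n)) = 18 ∧
    (inHabitat 805 && monskyS 805 == 1 && !(sigma1Odd 805 || sigma2Odd 805)) = true ∧
    (inHabitat 6279 && monskyS 6279 == 1 && !(sigma1Odd 6279 || sigma2Odd 6279)) = true := by
  native_decide

/-- **`𝒟₁ ∩ [1, 10⁴] = ∅`**: no odd square-free `n ≡ 5, 7 (mod 8)`, `n ≤ 10⁴`, has Monsky `s(n) ≥ 3` together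
with an odd TYZ genus sum. (Python replica: also empty for `n ≤ 2·10⁵`, 4881 members with `s ≥ 3`.) -/
theorem d1_empty_le_10000 : ((List.range 10001).all fun n => !bad n) = true := by native_decide

/-! ### The same census for `n ≤ 10⁵` (Python: habitat 20270, `s ≥ 3`: 2311 — `s = 3`: 2302, `s = 5`: 9 —,
silent `s = 1`: 278, `𝒟₁ = ∅`) -/

theorem habitat_count_le_100000 : countUpTo 100000 inHabitat = 20270 := by native_decide

theorem s_ge_three_count_le_100000 :
    countUpTo 100000 (fun n => inHabitat n && decide (3 ≤ monskyS n)) = 2311 := by native_decide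

theorem s_eq_five_count_le_100000 :
    countUpTo 100000 (fun n => inHabitat n && monskyS n == 5) = 9 := by native_decide

theorem silent_s1_count_le_100000 :
    countUpTo 100000 (fun n => inHabitat n && monskyS n == 1 && !(sigma1Odd n || sigma2Odd n)) = 278 := by
  native_decide

/-- **`𝒟₁ ∩ [1, 10⁵] = ∅`.** -/
theorem d1_empty_le_100000 : ((List.range 100001).all fun n => !bad n) = true := by native_decide

end Summit.BirchSwinnertonDyer.BirchSwinnertonDyer.Cruxes.UpperOffV0HSYPlus.RedeiLayerMatching.Census
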